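import Mathlib
import Literature.AlgebraicGeometry.Resolution.CobordantGame
import Literature.AlgebraicGeometry.Resolution.CobordantChartCoefficients
import Literature.AlgebraicGeometry.Resolution.CobordantChartPlaneSlice
import Literature.AlgebraicGeometry.Resolution.AxisPolyhedron
import Summits.ResolutionOfSingularities.ResolutionOfSingularities.Theorems.WeightedInvariantLocalWeightedDropApexFreeOrderDrop
import Summits.ResolutionOfSingularities.ResolutionOfSingularities.Theorems.WeightedInvariantLocalWeightedDropAxisPointMove
import Summits.ResolutionOfSingularities.ResolutionOfSingularities.Theorems.WeightedInvariantLocalWeightedDropAxisMove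
import Summits.ResolutionOfSingularities.ResolutionOfSingularities.Theorems.WeightedInvariantLocalWeightedDropAxisWeightedMoveSlice

/-!
# `LocalWeightedDrop` (stmt-ResolutionOfSingularities-8899), TOT2-LINE piece S-E1 (core, part 4):
# the EXITS of the `e = 1` regime in ORDER form — where the point move has no near successor

Route `ResolutionOfSingularities/WeightedInvariant`, crux `LocalWeightedDrop`, registered residual
`stub_spaceNCRankDrop` (skeleton v32), sub-line TOT2-LINE v1 §5 (E1) [OURS · L1 W4.3; AI-drafted, weaker than
expert review].  The count game T″ reads successors of the point move as (`s` times) the SLICE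
`G|_{y_{i₀} = 0}` at a live slot `i₀` (`c_{i₀} ≠ 0`) of an exceptional point `c ≠ 0`; "near" means slice order
`≥ d = ord`.  The weighted engine proved the corresponding facts in `Won` form only (B3 `stub_axisPointMove`,
`TangentConeCut.apexFreeStartsWon`); here they are exported in ORDER form, characteristic `p`
(`stub_apexFreeOrderDrop`), every dimension:
* `order_slice_lt_of_apexFree` — from a germ whose degree-`d` form has NO non-zero translation-invariance
  vector, EVERY successor slice has order `< d` (regime (E0));
* `order_slice_lt_offAxis` — from an AXIS GERM (`AxisCone`, `TrivialApexX`), every successor slice at an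
  exceptional point OFF the axis point has order `< d`: the only candidate near point is the axis point
  (CJS (N1) for `e = 1`, hypersurface form);
* `order_slice_lt_after_vertexLine` — the `δ = 2` EXIT (`k` infinite): for a prepared axis germ with `δ ≥ 2`
  and non-empty level-`2` line, the slice `Sl` at the axis point (order `d`, apex-free by
  `AxisWeightedMove.apexFree_slice` at `m = 1`) has, under ITS point move, no near successor at all.
* `order_slice_lt_axisMove` — the `δ = ∞` EXIT (CURVE MOVE): from `g ∈ (x')^d` with trivial apex inside
  `z = 0`, the blow-up of the equimultiple axis `V(x')` (weights `(1, …, 1, 0)`, a count move) has no near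
  successor: every slice has order `< d` (the order form of B4 `stub_axisMove`).
With `AxisPointMove.order_axisSlice_lt` (`δ < 2` ⇒ the axis-point slice has order `< d`) and
`AxisNearDescent.nearSucc_step` (`δ ≥ 2`, line empty ⇒ axis germ again, `δ ↦ δ - 1`, preparedness kept) this
lists every successor of every point move along the fundamental sequence of an `e = 1` point.
-/

set_option linter.dupNamespace false -- mandated namespace of this single-conjunct summit

namespace Summit.ResolutionOfSingularities.ResolutionOfSingularities.Theorems

open Literature.AlgebraicGeometry.Resolution

namespace AxisNearDescent

open MvPowerSeries AxisPolyhedron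

variable {k : Type} [Field k]

/-- **REGIME (E0): FROM AN APEX-FREE GERM NO SUCCESSOR OF THE POINT MOVE IS NEAR.**  If the degree-`d` form of
`g` (order `d`) has no non-zero translation-invariance vector, then at every exceptional point `c` and every live
slot `i₀` the slice of the `s`-saturated transform has order `< d` (`stub_apexFreeOrderDrop`: order `≥ d` would
make `c ≠ 0` an invariance vector). -/
theorem order_slice_lt_of_apexFree (p : ℕ) (hp : p.Prime) [CharP k p] {m : ℕ} {g : MvPowerSeries (Fin m) k}
    {d : ℕ} (hgd : g.order = d)
    (hfree : ∀ u : Fin m → k, u ≠ 0 → ∃ v : Fin m → k,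
      CobordantChart.initEval (fun _ : Fin m => 1) (v + u) d g ≠ CobordantChart.initEval (fun _ : Fin m => 1) v d g)
    {c : Fin m → k} {a : ℕ} {G : MvPowerSeries (Fin (m + 1)) k}
    (hfac : subst (CobordantChart.chart (fun _ : Fin m => 1) c) g = X 0 ^ a * G) (hndvd : ¬ (X (0 : Fin (m + 1)) ∣ G))
    (i₀ : Fin m) (hci₀ : c i₀ ≠ 0) :
    (subst (fun j : Fin (m + 1) => if j = i₀.succ then (0 : MvPowerSeries (Fin m) k)
      else X (Fin.predAbove i₀ j)) G).order < (d : ℕ∞) := by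
  by_contra hge
  push Not at hge
  have hinv := stub_apexFreeOrderDrop p hp k m g d hgd c a G hfac hndvd i₀ hci₀ hge
  obtain ⟨v, hv⟩ := hfree c (fun h0 => hci₀ (by rw [h0]; rfl))
  exact hv (hinv v)

/-- **CJS (N1) FOR `e = 1`: OFF THE AXIS POINT NO SUCCESSOR IS NEAR.**  For an axis germ `S` (order `d`, degree-`d`
form `F(x')` with trivial apex inside `z = 0`) and an exceptional point `c` with `c' = c|_{x'} ≠ 0`, every slice at a
live slot has order `< d`: order `≥ d` would make `c` an invariance vector (`stub_apexFreeOrderDrop`), and since the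
form only sees `x'` (`AxisPointMove.initEval_eq_of_axisCone`) so would be `(c', 0) ≠ 0` — against `TrivialApexX`. -/
theorem order_slice_lt_offAxis (p : ℕ) (hp : p.Prime) [CharP k p] {n : ℕ} {S : MvPowerSeries (Fin (n + 1)) k}
    {d : ℕ} (hSd : S.order = d) (hcone : AxisCone d S) (hapex : TrivialApexX d S)
    {c : Fin (n + 1) → k} {a : ℕ} {G : MvPowerSeries (Fin (n + 2)) k}
    (hfac : subst (CobordantChart.chart (fun _ : Fin (n + 1) => 1) c) S = X 0 ^ a * G)
    (hndvd : ¬ (X (0 : Fin (n + 2)) ∣ G)) (hc' : ∃ j : Fin n, c (Fin.castSucc j) ≠ 0)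
    (i₀ : Fin (n + 1)) (hci₀ : c i₀ ≠ 0) :
    (subst (fun j : Fin (n + 2) => if j = i₀.succ then (0 : MvPowerSeries (Fin (n + 1)) k)
      else X (Fin.predAbove i₀ j)) G).order < (d : ℕ∞) := by
  by_contra hge
  push Not at hge
  have hinv := stub_apexFreeOrderDrop p hp k (n + 1) S d hSd c a G hfac hndvd i₀ hci₀ hge
  obtain ⟨j, hj⟩ := hc'
  obtain ⟨v', hv'⟩ := hapex (fun j => c (Fin.castSucc j)) (fun h0 => hj (congrFun h0 j))
  refine hv' ((AxisPointMove.initEval_eq_of_axisCone hcone fun j' => ?_).trans (hinv _))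
  simp

/-- **THE `δ = 2` EXIT** (`k` infinite, characteristic `p`): for a PREPARED axis germ `S` of order `d` with
`δ(S) ≥ 2` and NON-EMPTY level-`2` line, the slice `Sl` at the axis point `c = (0, c_z)` is a germ of order `d`
(`AxisWeightedMove.order_slice_eq`) with apex-free degree-`d` form (`AxisWeightedMove.apexFree_slice`, `m = 1`), so
ITS point move has no near successor: every slice of every `s`-saturated transform of `Sl` has order `< d`. -/
theorem order_slice_lt_after_vertexLine (p : ℕ) (hp : p.Prime) [CharP k p] [Infinite k] {n : ℕ}
    {S : MvPowerSeries (Fin (n + 1)) k} {c : Fin (n + 1) → k}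
    (hc : ∀ j : Fin n, c (Fin.castSucc j) = 0) (hcz : c (Fin.last n) ≠ 0) {d : ℕ}
    {G : MvPowerSeries (Fin (n + 2)) k}
    (hfac : subst (CobordantChart.chart (fun _ : Fin (n + 1) => 1) c) S = X 0 ^ d * G)
    (hSd : S.order = d) (hS0 : S ≠ 0) (hlev : AboveLevel d 2 1 S) (hcone : AxisCone d S)
    (hapex : TrivialApexX d S) (hprep : PreparedAxis d S)
    (hline : ∃ E : Fin (n + 1) →₀ ℕ, xDeg E < d ∧ E (Fin.last n) = 2 * (d - xDeg E) ∧ coeff E S ≠ 0)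
    {c₂ : Fin (n + 1) → k} {a₂ : ℕ} {G₂ : MvPowerSeries (Fin (n + 2)) k}
    (hfac₂ : subst (CobordantChart.chart (fun _ : Fin (n + 1) => 1) c₂)
      (subst (fun j : Fin (n + 2) => if j = (Fin.last n).succ then (0 : MvPowerSeries (Fin (n + 1)) k)
        else X (Fin.predAbove (Fin.last n) j)) G) = X 0 ^ a₂ * G₂)
    (hndvd₂ : ¬ (X (0 : Fin (n + 2)) ∣ G₂)) (i₀ : Fin (n + 1)) (hci₀ : c₂ i₀ ≠ 0) :
    (subst (fun j : Fin (n + 2) => if j = i₀.succ then (0 : MvPowerSeries (Fin (n + 1)) k)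
      else X (Fin.predAbove i₀ j)) G₂).order < (d : ℕ∞) := by
  have hfac' : subst (CobordantChart.chart (fun _ : Fin (n + 1) => 1) c) S = X 0 ^ (1 * d) * G := by
    rw [Nat.one_mul]; exact hfac
  have hSlord := AxisWeightedMove.order_slice_eq (w := fun _ : Fin (n + 1) => 1) (m := 1) rfl (fun _ => rfl)
    le_rfl hfac' hc hlev hcone hSd hS0
  have hfree := AxisWeightedMove.apexFree_slice (w := fun _ : Fin (n + 1) => 1) (m := 1) rfl (fun _ => rfl)
    le_rfl hfac' hc hcz hlev hcone hapex hprep hline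
  exact order_slice_lt_of_apexFree p hp hSlord hfree hfac₂ hndvd₂ i₀ hci₀

/-- **THE `δ = ∞` EXIT: THE AXIS (CURVE) MOVE HAS NO NEAR SUCCESSOR** — the order form of B4 `stub_axisMove`.
For `g` singular of order `d` with `g ∈ (x')^d` (`InAxisIdeal`: the `z`-axis is equimultiple) and trivial apex
inside `z = 0`, blow up the axis with the weights `w = (1, …, 1, 0)`; at an exceptional point `c♭ = (c', 0)` (the
chart convention) with live slot `x'_{j₀}` and `g(chart) = s^a · G`, `s ∤ G`, the slice `G|_{y'_{j₀} = 0}` has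
order `< d`: otherwise (`tameSlice`: `G = u · Φ(cyl slice)`) `G` has order `≥ d`, the pure-`y'` part of `G` in
low degree vanishes, and `AxisMove.initEval_add_eq` makes `(c', 0) ≠ 0` an invariance vector inside `z = 0`. -/
theorem order_slice_lt_axisMove (p : ℕ) (hp : p.Prime) [CharP k p] {n : ℕ} {g : MvPowerSeries (Fin (n + 1)) k}
    (hg : CobordantGame.IsSingular k g) {d : ℕ} (hgd : g.order = d) (hin : InAxisIdeal d g)
    (hapex : TrivialApexX d g) {w : Fin (n + 1) → ℕ} (hw0 : w (Fin.last n) = 0)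
    (hw1 : ∀ j, w (Fin.castSucc j) = 1) {cf : Fin (n + 1) → k} (hcfz : cf (Fin.last n) = 0) {a : ℕ}
    {G : MvPowerSeries (Fin (n + 2)) k}
    (hfac : subst (CobordantChart.chart w cf) g = X 0 ^ a * G) (hndvd : ¬ (X (0 : Fin (n + 2)) ∣ G))
    (j₀ : Fin n) (hcfj₀ : cf (Fin.castSucc j₀) ≠ 0) :
    (subst (fun l : Fin (n + 2) => if l = (Fin.castSucc j₀).succ then (0 : MvPowerSeries (Fin (n + 1)) k)
      else X (Fin.predAbove (Fin.castSucc j₀) l)) G).order < (d : ℕ∞) := by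
  have hconv : ∀ i, w i = 0 → cf i = 0 := AxisMove.convention hw1 hcfz
  -- `a = d`: the `w`-order of `g ∈ (x')^d` is `d`
  have had : a = d := by
    have h : (a : ℕ∞) = g.weightedOrder w :=
      CobordantChart.eq_weightedOrder_of_factor w cf hconv hg.1 hfac hndvd
    rw [AxisMove.weightedOrder_eq hw0 hw1 hin hgd hg.1] at h
    exact_mod_cast h
  rw [had] at hfac
  -- tame slice at the slot `j₀` (weight `1`, never divisible by `p`)
  have hp1 : ¬ p ∣ w (Fin.castSucc j₀) := by
    rw [hw1]
    exact fun h => hp.one_lt.ne' (Nat.dvd_one.mp h)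
  obtain ⟨Φ, u, hΦ0, -, hu, hGu⟩ :=
    tameSlice p hp k (n + 1) g w cf hconv d G hfac (Fin.castSucc j₀) hcfj₀ hp1
  by_contra hge
  push Not at hge
  have hGord : (d : ℕ∞) ≤ G.order := by
    rw [hGu]
    refine le_trans ?_ MvPowerSeries.le_order_mul
    refine le_trans ?_ le_add_self
    refine le_trans ?_ (ApexFreeOrderDrop.order_le_order_subst hΦ0 _)
    exact le_trans hge (ApexFreeOrderDrop.order_le_order_subst (fun m => MvPowerSeries.constantCoeff_X _) _)
  have hGβ : ∀ β : Fin (n + 1) →₀ ℕ, β (Fin.last n) = 0 → β.degree < d →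
      MvPowerSeries.coeff (Finsupp.cons 0 β) G = 0 := fun β _ hβd =>
    MvPowerSeries.coeff_of_lt_order
      (lt_of_lt_of_le (by rw [AxisMove.degree_cons_zero]; exact_mod_cast hβd) hGord)
  -- `u := c' ≠ 0` and `c♭ = (u, 0)`
  have hu0 : (fun j : Fin n => cf (Fin.castSucc j)) ≠ 0 := fun h => hcfj₀ (congrFun h j₀)
  have hsnoc : (Fin.snoc (fun j : Fin n => cf (Fin.castSucc j)) 0 : Fin (n + 1) → k) = cf := by
    funext l
    refine Fin.lastCases ?_ (fun j => ?_) l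
    · rw [Fin.snoc_last, hcfz]
    · rw [Fin.snoc_castSucc]
  obtain ⟨v, hv⟩ := hapex _ hu0
  rw [hsnoc] at hv
  exact hv (AxisMove.initEval_add_eq hw0 hw1 hcfz hin hfac hGβ _)

end AxisNearDescent

end Summit.ResolutionOfSingularities.ResolutionOfSingularities.Theorems
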